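import Literature.AlgebraicGeometry.Resolution.RsopMonomialIdeals
import Mathlib.RingTheory.Localization.AtPrime.Basic
import HarnessLib

/-!
# Orders along an axial substitution `xᵢ ↦ yᵢ tʲ` into a regular local ring

Topic: `Literature/AlgebraicGeometry/Resolution`. The elementary order computation behind the
"test blow-ups" of an ideal exponent along a line of new variables (Hironaka's numerical
character of `𝔖(E)`; Cossart–Piltant's near points read at generic points): after `j` point
blow-ups of `(ξ, 0) ∈ Z × 𝔸¹` following the `t`-axis, the local ring `L = 𝒪_{W(j), P_j}` is
regular with a regular system of parameters `(t, y₁, …, y_n)` and the composite local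
homomorphism `φ : S = 𝒪_{Z,ξ} → L` sends a regular system of parameters `x` of `S` to
`φ(xᵢ) = yᵢ · tʲ`. PROVED here, for such a `φ` (in fact for ANY ring homomorphism `φ` from a local
ring `S` whose maximal ideal is generated by `x`, into a regular local ring `L` in which
`(t, y)` is part of a regular system of parameters):

* `Ideal.map_le_pow_of_axial` / `Ideal.not_map_le_pow_succ_of_axial` — **an ideal `𝔞 ⊆ S` of
  order exactly `μ` (`𝔞 ⊆ 𝔪_S^μ`, `𝔞 ⊄ 𝔪_S^{μ+1}`) extends to an ideal `𝔞L` of order exactly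
  `(j+1)μ`** (the initial form of a generator is a form of degree `μ` with a unit coefficient;
  substituted it is a form of degree `(j+1)μ` in the regular system of parameters of `L` with a unit
  coefficient, hence not in `𝔪_L^{(j+1)μ+1}` by Matsumura 17.10, `coeff_mem_maximalIdeal_of_eval_mem_pow`);
* `Ideal.span_pow_mul_le_pow_iff` — **division by the exceptional parameter**: for `t ∉ 𝔪_L²`,
  `tᵏ · 𝔟 ⊆ 𝔪_L^{m+k} ↔ 𝔟 ⊆ 𝔪_L^m` (orders add in a regular local ring,
  `RegularLocalOrder.lean`);
* `exists_eq_pow_mul_not_mem_span_of_axial` — **the `t`-adic value**: an element of `𝔞` of order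
  exactly `μ` maps to `t^{jμ} · g` with `g ∉ (t)`; hence (`Ideal.map_map_eq_pow_of_axial`) in the
  localisation `L_{(t)}` (a discrete valuation ring) `𝔞 · L_{(t)} = 𝔪^{jμ}`.

These are the local computations of Eq. (15)–(18) pp.13–14 of H. Hironaka's 2017 manuscript
(ADJUDICATED elsewhere, not cited as fact; the statements here are [folklore] commutative algebra,
valid in any characteristic and for any residue field).

## Sources

* H. Matsumura, *Commutative Ring Theory*, CUP 1986, Thm. 14.2, Thm. 17.10 (through
  `RegularSystemOfParameters.lean`, `RsopMonomialIdeals.lean`). [Matsumura1987]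
* O. Zariski, P. Samuel, *Commutative Algebra* II, Ch. VIII §1 Thm. 1 (the order valuation of a
  regular local ring; `RegularLocalOrder.lean`). [ZariskiSamuel1960]
* V. Cossart, O. Piltant, J. Algebra 320 (2008), proof of Prop. 4.2 (11): orders in the charts of a
  blowing up read at generic points. [CossartPiltant2008]
-/

noncomputable section

namespace Literature.AlgebraicGeometry.Resolution

universe u

open IsLocalRing MvPolynomial

/-! ## Homogeneous forms: scaling the variables -/

section Forms

variable {R : Type u} [CommRing R] {σ : Type*}

/-- A form of degree `μ` evaluated at `s · y` is `s^μ` times its value at `y`. [folklore] -/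
private theorem eval_const_mul_of_isHomogeneous {F : MvPolynomial σ R} {μ : ℕ} (hF : F.IsHomogeneous μ)
    (s : R) (y : σ → R) : eval (fun i => s * y i) F = s ^ μ * eval y F := by
  classical
  conv_lhs => rw [F.as_sum]
  conv_rhs => rw [F.as_sum]
  rw [map_sum, map_sum, Finset.mul_sum]
  refine Finset.sum_congr rfl fun d hd => ?_
  have hdeg : ∑ i ∈ d.support, d i = μ := by
    have h := hF (mem_support_iff.mp hd)
    simpa [Finsupp.weight_apply, Finsupp.sum, smul_eq_mul, mul_one] using h
  rw [eval_monomial, eval_monomial]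
  have : (d.prod fun i k => (s * y i) ^ k) = s ^ μ * d.prod fun i k => y i ^ k := by
    simp only [Finsupp.prod, mul_pow, Finset.prod_mul_distrib, Finset.prod_pow_eq_pow_sum, hdeg]
  rw [this]
  ring

/-- If all coefficients of a form of degree `μ` in generators `x` of an ideal `I` lie in an ideal
`K`, its value lies in `K · I^μ` (contrapositive use: a form whose value is NOT in `𝔪 · 𝔪^μ` has a
coefficient outside `𝔪`). [folklore] -/
private theorem exists_coeff_not_mem_of_eval_not_mem {F : MvPolynomial σ R} {μ : ℕ}
    (hF : F.IsHomogeneous μ) (x : σ → R) (K : Ideal R)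
    (h : eval x F ∉ K * Ideal.span (Set.range x) ^ μ) : ∃ m, F.coeff m ∉ K := by
  by_contra hall
  push Not at hall
  exact h (eval_mem_mul_span_pow x hF (mem_map_C_iff.mpr hall))

end Forms

/-! ## The substituted form -/

section Axial

variable {S : Type u} [CommRing S] {L : Type u} [CommRing L]
variable {n : ℕ} (x : Fin n → S) (φ : S →+* L) (t : L) (y : Fin n → L) (j : ℕ)

variable {x φ t y j}

/-! The substituted initial form is `G = F^φ(Y₁, …, Y_n) · T^{jμ}`, i.e.
`rename Fin.succ (map φ F) * X 0 ^ (j * μ)` in the variables `(T, Y) = Fin.cons t y`; it is kept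
inline (no definition) in the four lemmas below. -/

/-- `G` is homogeneous of degree `(j+1)μ`. [folklore] -/
private theorem isHomogeneous_axialForm {μ : ℕ} {F : MvPolynomial (Fin n) S} (hF : F.IsHomogeneous μ) :
    (rename Fin.succ (map φ F) * X 0 ^ (j * μ) : MvPolynomial (Fin (n + 1)) L).IsHomogeneous ((j + 1) * μ) := by
  have h1 : (rename Fin.succ (map φ F)).IsHomogeneous μ := (hF.map φ).rename_isHomogeneous
  have h2 : (X (0 : Fin (n + 1)) ^ (j * μ) : MvPolynomial (Fin (n + 1)) L).IsHomogeneous (j * μ) := by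
    simpa using (isHomogeneous_X (R := L) (0 : Fin (n + 1))).pow (j * μ)
  have := h1.mul h2
  rwa [show μ + j * μ = (j + 1) * μ by ring] at this

/-- `G(t, y) = t^{jμ} · F^φ(y)`. [folklore] -/
private theorem eval_cons_axialForm (μ : ℕ) (F : MvPolynomial (Fin n) S) :
    eval (Fin.cons t y : Fin (n + 1) → L) (rename Fin.succ (map φ F) * X 0 ^ (j * μ) : MvPolynomial (Fin (n + 1)) L) =
      t ^ (j * μ) * eval y (map φ F) := by
  rw [map_mul, map_pow, eval_X, eval_rename, Fin.cons_zero]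
  have : ((Fin.cons t y : Fin (n + 1) → L) ∘ Fin.succ) = y := by
    ext i; simp
  rw [this, mul_comm]

/-- The coefficient of `G` at the monomial `Y^m T^{jμ}` is `φ(F_m)`. [folklore] -/
private theorem coeff_axialForm (μ : ℕ) (F : MvPolynomial (Fin n) S) (m : Fin n →₀ ℕ) :
    (rename Fin.succ (map φ F) * X 0 ^ (j * μ) : MvPolynomial (Fin (n + 1)) L).coeff
      (m.mapDomain Fin.succ + Finsupp.single 0 (j * μ)) = φ (F.coeff m) := by
  rw [X_pow_eq_monomial, coeff_mul_monomial, mul_one,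
    coeff_rename_mapDomain _ (Fin.succ_injective n), coeff_map]

/-- Under `φ(xᵢ) = yᵢ tʲ`, the value `f = F(x)` of a form of degree `μ` maps to `G(t, y)`.
[folklore] -/
private theorem map_eval_eq_eval_axialForm (hφ : ∀ i, φ (x i) = y i * t ^ j) {μ : ℕ}
    {F : MvPolynomial (Fin n) S} (hF : F.IsHomogeneous μ) :
    φ (eval x F) = eval (Fin.cons t y : Fin (n + 1) → L) (rename Fin.succ (map φ F) * X 0 ^ (j * μ) : MvPolynomial (Fin (n + 1)) L) := by
  rw [eval_cons_axialForm]
  have h1 : φ (eval x F) = eval (fun i => φ (x i)) (map φ F) := by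
    rw [eval_map]
    exact hom_eval₂ F (RingHom.id S) φ x
  have h2 : (fun i => φ (x i)) = fun i => t ^ j * y i := by
    ext i; rw [hφ i, mul_comm]
  rw [h1, h2, eval_const_mul_of_isHomogeneous (hF.map φ), ← pow_mul]

/-! ## Orders of extended ideals -/

variable [IsLocalRing S] [IsLocalRing L]

/-- **Upper inclusion**: if `𝔪_S = (x)`, `φ(xᵢ) = yᵢ tʲ` with `t, yᵢ ∈ 𝔪_L`, then
`𝔞 ⊆ 𝔪_S^μ` implies `𝔞L ⊆ 𝔪_L^{(j+1)μ}` (the easy half of the order computation in the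
charts of a point blowing up read along an axis, Cossart–Piltant (10)–(11)).
[cite: CossartPiltant2008, proof of Prop. 4.2, (10)–(11) p. 8] -/
theorem Ideal.map_le_pow_of_axial (hx : Ideal.span (Set.range x) = maximalIdeal S)
    (hφ : ∀ i, φ (x i) = y i * t ^ j) (ht : t ∈ maximalIdeal L) (hy : ∀ i, y i ∈ maximalIdeal L)
    {𝔞 : Ideal S} {μ : ℕ} (h : 𝔞 ≤ maximalIdeal S ^ μ) :
    𝔞.map φ ≤ maximalIdeal L ^ ((j + 1) * μ) := by
  have h1 : (maximalIdeal S).map φ ≤ maximalIdeal L ^ (j + 1) := by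
    rw [← hx, Ideal.map_span, Ideal.span_le]
    rintro _ ⟨_, ⟨i, rfl⟩, rfl⟩
    rw [hφ i, pow_succ', SetLike.mem_coe]
    exact Ideal.mul_mem_mul (hy i) (Ideal.pow_mem_pow ht j)
  calc 𝔞.map φ ≤ (maximalIdeal S ^ μ).map φ := Ideal.map_mono h
    _ = ((maximalIdeal S).map φ) ^ μ := Ideal.map_pow φ _ μ
    _ ≤ (maximalIdeal L ^ (j + 1)) ^ μ := Ideal.pow_right_mono h1 μ
    _ = maximalIdeal L ^ ((j + 1) * μ) := by rw [← pow_mul]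

/-- An element of `𝔪_S^μ ∖ 𝔪_S^{μ+1}` is a form of degree `μ` in the generators `x` of `𝔪_S`
with a unit coefficient. [folklore] -/
private theorem exists_form_unit_coeff (hx : Ideal.span (Set.range x) = maximalIdeal S) {μ : ℕ} {f : S}
    (hf : f ∈ maximalIdeal S ^ μ) (hf' : f ∉ maximalIdeal S ^ (μ + 1)) :
    ∃ F : MvPolynomial (Fin n) S, F.IsHomogeneous μ ∧ eval x F = f ∧ ∃ m, IsUnit (F.coeff m) := by
  rw [← hx] at hf
  obtain ⟨F, hF, hFf⟩ := exists_isHomogeneous_of_mem_span_pow x μ hf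
  have h : eval x F ∉ maximalIdeal S * Ideal.span (Set.range x) ^ μ := by
    rw [hFf, hx, ← pow_succ']
    exact hf'
  obtain ⟨m, hm⟩ := exists_coeff_not_mem_of_eval_not_mem hF x _ h
  exact ⟨F, hF, hFf, m, (IsLocalRing.notMem_maximalIdeal).mp hm⟩

/-- **Lower exactness** (Matsumura 17.10 in `L`): with `(t, y)` part of a regular system of
parameters of the regular local ring `L`, `𝔪_S = (x)`, `φ(xᵢ) = yᵢ tʲ`, an ideal `𝔞 ⊆ 𝔪_S^μ` NOT
contained in `𝔪_S^{μ+1}` extends to `𝔞L ⊄ 𝔪_L^{(j+1)μ+1}`: a generator of order `μ` is a form with a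
unit coefficient, and so is its substituted form of degree `(j+1)μ`.
[cite: Matsumura1987, Thm. 17.10] -/
theorem Ideal.not_map_le_pow_succ_of_axial (hx : Ideal.span (Set.range x) = maximalIdeal S)
    (hφ : ∀ i, φ (x i) = y i * t ^ j) (hc : IsRsopPart (Fin.cons t y : Fin (n + 1) → L))
    {𝔞 : Ideal S} {μ : ℕ} (h : 𝔞 ≤ maximalIdeal S ^ μ) (h' : ¬ 𝔞 ≤ maximalIdeal S ^ (μ + 1)) :
    ¬ 𝔞.map φ ≤ maximalIdeal L ^ ((j + 1) * μ + 1) := by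
  classical
  haveI := hc.isRegularLocalRing
  obtain ⟨f, hf𝔞, hf⟩ := Set.not_subset.mp h'
  obtain ⟨F, hF, hFf, m, hm⟩ := exists_form_unit_coeff hx (h hf𝔞) hf
  -- the substituted form, renamed into a full regular system of parameters extending `(t, y)`
  obtain ⟨e, x', hd, hx', hx'c⟩ := hc.exists_rsop
  let G : MvPolynomial (Fin (n + 1)) L := rename Fin.succ (map φ F) * X 0 ^ (j * μ)
  let G' : MvPolynomial (Fin (n + 1 + e)) L := rename (Fin.castAdd e) G
  have hG' : G'.IsHomogeneous ((j + 1) * μ) := (isHomogeneous_axialForm hF).rename_isHomogeneous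
  have hcomp : (x' ∘ Fin.castAdd e) = (Fin.cons t y : Fin (n + 1) → L) := funext hx'c
  have heval : eval x' G' = φ f := by
    rw [eval_rename, hcomp, ← hFf, map_eval_eq_eval_axialForm hφ hF]
  -- its distinguished coefficient is the unit `φ(F_m)`
  let d : Fin (n + 1) →₀ ℕ := m.mapDomain Fin.succ + Finsupp.single 0 (j * μ)
  have hcoeff : G'.coeff (d.mapDomain (Fin.castAdd e)) = φ (F.coeff m) := by
    rw [coeff_rename_mapDomain _ (Fin.castAdd_injective _ _), coeff_axialForm]
  intro hle
  have hmem : eval x' G' ∈ maximalIdeal L ^ ((j + 1) * μ + 1) := by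
    rw [heval]
    exact hle (Ideal.mem_map_of_mem φ hf𝔞)
  have := coeff_mem_maximalIdeal_of_eval_mem_pow hd x' hx' hG' hmem (d.mapDomain (Fin.castAdd e))
  rw [hcoeff] at this
  exact (IsLocalRing.notMem_maximalIdeal.mpr (hm.map φ)) this

/-! ## Division by the exceptional parameter -/

/-- **`tᵏ 𝔟 ⊆ 𝔪^{m+k} ↔ 𝔟 ⊆ 𝔪^m`** in a regular local ring, for `t ∉ 𝔪²` (orders add:
`ord(tᵏ g) = k + ord g`). [cite: ZariskiSamuel1960, Ch. VIII §1 Thm. 1] -/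
theorem Ideal.span_pow_mul_le_pow_iff (hL : IsRegularLocalRing L) {t : L} (ht : t ∈ maximalIdeal L)
    (ht2 : t ∉ maximalIdeal L ^ 2) (𝔟 : Ideal L) (k m : ℕ) :
    Ideal.span {t ^ k} * 𝔟 ≤ maximalIdeal L ^ (m + k) ↔ 𝔟 ≤ maximalIdeal L ^ m := by
  haveI := hL
  constructor
  · intro h g hg
    by_contra hgm
    cases m with
    | zero => exact hgm (by rw [pow_zero, Ideal.one_eq_top]; exact Submodule.mem_top)
    | succ m' =>
      have h1 : t ^ k ∉ maximalIdeal L ^ (k * 1 + 1) :=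
        pow_not_mem_pow_of_not_mem_pow (p := 1) (by rwa [show (1 : ℕ) + 1 = 2 by rfl]) k
      rw [mul_one] at h1
      have h2 := mul_not_mem_pow_of_not_mem_pow h1 hgm
      refine h2 (Ideal.pow_le_pow_right (by omega) (h ?_))
      exact Ideal.mul_mem_mul (Ideal.mem_span_singleton_self _) hg
  · intro h
    calc Ideal.span {t ^ k} * 𝔟 ≤ maximalIdeal L ^ k * maximalIdeal L ^ m := by
          refine Ideal.mul_mono ?_ h
          rw [Ideal.span_singleton_le_iff_mem]
          exact Ideal.pow_mem_pow ht k
      _ = maximalIdeal L ^ (m + k) := by rw [← pow_add, add_comm]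

/-! ## The `t`-adic value of the extended ideal -/

/-- **The `t`-adic value of a generator of order `μ`**: with `(t, y)` part of a regular system of
parameters of `L`, `𝔪_S = (x)` and `φ(xᵢ) = yᵢ tʲ`, an element `f ∈ 𝔪_S^μ ∖ 𝔪_S^{μ+1}` maps to
`φ(f) = t^{jμ} · g` with `g ∉ (t)` (the initial form of `f`, read in the regular ring `L/(t)` with
parameters `ȳ`, is nonzero). [cite: Matsumura1987, Thm. 17.10] -/
theorem exists_eq_pow_mul_not_mem_span_of_axial (hx : Ideal.span (Set.range x) = maximalIdeal S)
    (hφ : ∀ i, φ (x i) = y i * t ^ j) (hc : IsRsopPart (Fin.cons t y : Fin (n + 1) → L))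
    {μ : ℕ} {f : S} (hf : f ∈ maximalIdeal S ^ μ) (hf' : f ∉ maximalIdeal S ^ (μ + 1)) :
    ∃ g : L, φ f = t ^ (j * μ) * g ∧ g ∉ Ideal.span {t} := by
  classical
  haveI := hc.isRegularLocalRing
  obtain ⟨F, hF, hFf, m, hm⟩ := exists_form_unit_coeff hx hf hf'
  have hφf : φ f = t ^ (j * μ) * eval y (map φ F) := by
    rw [← hFf, map_eval_eq_eval_axialForm hφ hF, eval_cons_axialForm]
  refine ⟨eval y (map φ F), hφf, ?_⟩
  -- `g = F^φ(y)` is a form of degree `μ` in `y` with a unit coefficient; if `g = t h`, then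
  -- `h ∈ 𝔪^{μ-1}` is a form of degree `μ - 1` in `(t, y)` and `F^φ(Y) - T·H` is a form of degree
  -- `μ` vanishing at `(t, y)` with a unit coefficient — impossible by Matsumura 17.10.
  obtain ⟨e, x', hd, hx', hx'c⟩ := hc.exists_rsop
  have ht : t ∈ maximalIdeal L := by
    have := hc.mem_maximalIdeal 0
    rwa [Fin.cons_zero] at this
  have ht2 : t ∉ maximalIdeal L ^ 2 := by
    have := hc.not_mem_sq 0
    rwa [Fin.cons_zero] at this
  -- the form `Gy = F^φ(Y)` in all the variables `x'`
  let ι : Fin n → Fin (n + 1 + e) := Fin.castAdd e ∘ Fin.succ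
  have hι : Function.Injective ι := (Fin.castAdd_injective _ _).comp (Fin.succ_injective n)
  let Gy : MvPolynomial (Fin (n + 1 + e)) L := rename ι (map φ F)
  have hGy : Gy.IsHomogeneous μ := (hF.map φ).rename_isHomogeneous
  have hx'ι : x' ∘ ι = y := by
    ext i
    change x' (Fin.castAdd e (Fin.succ i)) = y i
    rw [hx'c]; rfl
  have hevalGy : eval x' Gy = eval y (map φ F) := by rw [eval_rename, hx'ι]
  have hcoeffGy : Gy.coeff (m.mapDomain ι) = φ (F.coeff m) := by
    rw [coeff_rename_mapDomain _ hι, coeff_map]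
  intro hmem
  rw [Ideal.mem_span_singleton'] at hmem
  obtain ⟨h, hh⟩ := hmem
  -- `g ∈ 𝔪^μ`, hence `h ∈ 𝔪^{μ-1}` … unless `μ = 0`, where `f`, hence `g = φ f`, is a unit
  cases μ with
  | zero =>
    have hfu : IsUnit f := by
      rw [zero_add, pow_one] at hf'
      exact IsLocalRing.notMem_maximalIdeal.mp hf'
    have hgu : IsUnit (eval y (map φ F)) := by
      have : eval y (map φ F) = φ f := by rw [hφf, mul_zero, pow_zero, one_mul]
      rw [this]; exact hfu.map φ
    have : eval y (map φ F) ∈ maximalIdeal L := by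
      rw [← hh]; exact Ideal.mul_mem_left _ _ ht
    exact (IsLocalRing.notMem_maximalIdeal.mpr hgu) this
  | succ μ' =>
    have hg : eval y (map φ F) ∈ maximalIdeal L ^ (μ' + 1) := by
      rw [← hevalGy, ← hx']
      exact eval_mem_span_pow x' hGy
    have hh1 : h ∈ maximalIdeal L ^ μ' := by
      have := (Ideal.span_pow_mul_le_pow_iff hc.isRegularLocalRing ht ht2 (Ideal.span {h}) 1 μ').mp ?_
      · exact this (Ideal.mem_span_singleton_self h)
      rw [pow_one, Ideal.span_singleton_mul_span_singleton, Ideal.span_singleton_le_iff_mem,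
        mul_comm, hh]
      exact hg
    rw [← hx'] at hh1
    obtain ⟨H, hH, hHh⟩ := exists_isHomogeneous_of_mem_span_pow x' μ' hh1
    -- the form `Φ = Gy - X₀ · H` of degree `μ' + 1` vanishes at `x'`
    let i0 : Fin (n + 1 + e) := Fin.castAdd e 0
    have hx'0 : x' i0 = t := by
      change x' (Fin.castAdd e 0) = t
      rw [hx'c]; rfl
    let Φ : MvPolynomial (Fin (n + 1 + e)) L := Gy - X i0 * H
    have hΦ : Φ.IsHomogeneous (μ' + 1) := by
      refine hGy.sub ?_
      have := (isHomogeneous_X (R := L) i0).mul hH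
      rw [Nat.add_comm 1 μ'] at this
      exact this
    have hΦ0 : eval x' Φ = 0 := by
      change eval x' (Gy - X i0 * H) = 0
      rw [map_sub, map_mul, eval_X, hevalGy, hHh, hx'0, ← hh, mul_comm, sub_self]
    have hall := coeff_mem_maximalIdeal_of_eval_mem_pow hd x' hx' hΦ
      (by rw [hΦ0]; exact zero_mem _) (m.mapDomain ι)
    -- but the coefficient of `Φ` at `Y^m` is the unit `φ(F_m)` (the `X₀ H` part does not touch it)
    have hcoeffΦ : Φ.coeff (m.mapDomain ι) = φ (F.coeff m) := by
      change (Gy - X i0 * H).coeff (m.mapDomain ι) = _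
      rw [coeff_sub, hcoeffGy, coeff_X_mul', if_neg, sub_zero]
      rw [Finsupp.mem_support_iff, not_not, Finsupp.mapDomain_notin_range]
      rintro ⟨i, hi⟩
      exact Fin.castAdd_injective _ _ |>.ne (Fin.succ_ne_zero i) hi
    rw [hcoeffΦ] at hall
    exact (IsLocalRing.notMem_maximalIdeal.mpr (hm.map φ)) hall

/-- **The extended ideal in the discrete valuation ring `L_{(t)}`**: under the hypotheses of
`exists_eq_pow_mul_not_mem_span_of_axial`, for an ideal `𝔞 ⊆ 𝔪_S^μ` not contained in
`𝔪_S^{μ+1}` and any localisation `Lₜ` of `L` at the prime `(t)`, `𝔞 · Lₜ = 𝔪_{Lₜ}^{jμ}`.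
[cite: Matsumura1987, Thm. 17.10] -/
theorem Ideal.map_map_eq_pow_of_axial (hx : Ideal.span (Set.range x) = maximalIdeal S)
    (hφ : ∀ i, φ (x i) = y i * t ^ j) (hc : IsRsopPart (Fin.cons t y : Fin (n + 1) → L))
    {𝔞 : Ideal S} {μ : ℕ} (h : 𝔞 ≤ maximalIdeal S ^ μ) (h' : ¬ 𝔞 ≤ maximalIdeal S ^ (μ + 1))
    (Lt : Type u) [CommRing Lt] [Algebra L Lt] [IsLocalRing Lt]
    [(Ideal.span {t} : Ideal L).IsPrime] [IsLocalization.AtPrime Lt (Ideal.span {t} : Ideal L)] :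
    (𝔞.map φ).map (algebraMap L Lt) = maximalIdeal Lt ^ (j * μ) := by
  haveI := hc.isRegularLocalRing
  have hmax : maximalIdeal Lt = (Ideal.span {t} : Ideal L).map (algebraMap L Lt) :=
    (IsLocalization.AtPrime.map_eq_maximalIdeal (Ideal.span {t}) Lt).symm
  have hmaxt : maximalIdeal Lt = Ideal.span {algebraMap L Lt t} := by
    rw [hmax, Ideal.map_span, Set.image_singleton]
  have hy : ∀ i, y i ∈ maximalIdeal L := fun i => by
    have := hc.mem_maximalIdeal i.succ
    rwa [Fin.cons_succ] at this
  apply le_antisymm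
  · -- every generator `φ f`, `f ∈ 𝔞 ⊆ (x)^μ`, lies in `(t^j)^μ`
    rw [Ideal.map_map, Ideal.map_le_iff_le_comap]
    intro f hf
    have hfx : f ∈ Ideal.span (Set.range x) ^ μ := hx ▸ h hf
    obtain ⟨F, hF, hFf⟩ := exists_isHomogeneous_of_mem_span_pow x μ hfx
    rw [Ideal.mem_comap, RingHom.comp_apply, ← hFf, map_eval_eq_eval_axialForm hφ hF,
      eval_cons_axialForm, map_mul, map_pow, hmaxt, Ideal.span_singleton_pow]
    exact Ideal.mul_mem_right _ _ (Ideal.mem_span_singleton_self _)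
  · obtain ⟨f, hf𝔞, hf⟩ := Set.not_subset.mp h'
    obtain ⟨g, hfg, hg⟩ := exists_eq_pow_mul_not_mem_span_of_axial hx hφ hc (h hf𝔞) hf
    have hgu : IsUnit (algebraMap L Lt g) := by
      apply IsLocalization.map_units Lt (⟨g, hg⟩ : (Ideal.span {t} : Ideal L).primeCompl)
    rw [hmaxt, Ideal.span_singleton_pow, Ideal.span_singleton_le_iff_mem]
    have hmem : algebraMap L Lt (φ f) ∈ (𝔞.map φ).map (algebraMap L Lt) :=
      Ideal.mem_map_of_mem _ (Ideal.mem_map_of_mem _ hf𝔞)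
    rw [hfg, map_mul, map_pow] at hmem
    have := Ideal.mul_mem_right (hgu.unit⁻¹ : Ltˣ).val _ hmem
    rwa [mul_assoc, IsUnit.mul_val_inv, mul_one] at this

end Axial

end Literature.AlgebraicGeometry.Resolution

end
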